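import Summits.SmoothPoincare4.SmoothPoincare4.Theses.EntropyRung
import Summits.SmoothPoincare4.SmoothPoincare4.Theorems.EntropyRungNoncompactShrinkerGapStubCompactSupportLSIMixture
import Literature.Geometry.Lorentzian.Basic
import Literature.Geometry.Riemannian.ShrinkerEntropy
import Literature.Geometry.Riemannian.ShrinkerEntropyProofs
import Literature.Geometry.Riemannian.ShrinkerPotentialGrowth

/-!
# Stub `stub_compactSupportLSI` (U1) of line `collapsed-ends-usc` (crux
# `EntropyRung.NoncompactShrinkerGap`, stmt-SmoothPoincare4-10868): Carrillo–Ni's logarithmic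
# Sobolev inequality for compactly supported test functions

On a complete connected normalised gradient shrinker `(M, g, f)` (`Ric + Hess f = g/2`,
`R + |∇f|² = f`, closed `g`-balls compact) and for every smooth compactly supported `w` with
`Z = ∫ w² dV > 0`,
`log((4π)^{-n/2} ∫ e^{-f} dV) ≤ (∫ (R w² + 4|∇w|² − w² log w²) dV)/Z + log Z + log (4π)^{-n/2} − n`
(Haslhofer–Müller 2011, (2.15)–(2.16); at `n = 4` the registered signature, with
`log (4π)^{-2} = −log (4π)²`; `E4 = EuclideanSpace ℝ (Fin 4)` is the abbrev of
`Literature/Geometry/Lorentzian/Basic.lean`). PROOF (mixtures), from the two named facts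
`shrinkerPotentialGrowth` (Haslhofer–Müller 2011 §2: `R ≥ 0`, quadratic growth of `f`) and
`CarrilloNi2009_shrinkerLSI` (Carrillo–Ni 2009 Thm. 1.1: (i) `e^{-f} ∈ L¹`, (ii) the LSI
`log Θ ≤ 𝒲(g, ψ, 1)` for smooth compatible `ψ` of bounded second moment with integrable
`𝒲`-integrand, (iii) `𝒲(g, f + log Θ, 1) = log Θ`): for `0 < δ < 1` the smooth POSITIVE unit-mass
density `u_δ = (1−δ) w²/Z + δ e^{-f}/∫e^{-f}` defines a smooth compatible
`ψ_δ = log (4π)^{-n/2} − log u_δ`; its second moment and `𝒲`-integrand are integrable because `f`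
is proper (growth of `f` + compact balls ⇒ `e^{-f}, f e^{-f}, R e^{-f}, |∇f|² e^{-f} ∈ L¹`,
`ShrinkerEntropyProofs`) and `d(p, ·)² ≤ 8 f + 50 n²`; (ii) gives `log Θ ≤ 𝒲(ψ_δ)`, and pointwise
`𝒲`-integrand`(ψ_δ) ≤ (1−δ)/Z · [R w² + 4|∇w|² − w² log w² + (log Z + log A − n − log (1−δ)) w²]
 + δ/∫e^{-f} · [(R + |∇f|² + f + log Θ − n − log δ) e^{-f}]`
(linearity of `R u`, `−n u`; the perspective inequality for `|∇u|²/u`; subadditivity of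
`−x log x`), whose integral is `(1−δ) F(w) + δ log Θ − (1−δ) log (1−δ) − δ log δ` by (iii). Letting
`δ → 0` gives the claim. The pointwise/real-variable lemmas are in the sibling file
`EntropyRungNoncompactShrinkerGapStubCompactSupportLSIMixture.lean`. Everything here is proved;
no definition and no named fact is introduced. The hypothesis `R ≤ C` of the registered signature
is not needed.
-/

noncomputable section

-- `Summit.SmoothPoincare4.SmoothPoincare4.…` (summit = problem) trips `dupNamespace` on every decl.
set_option linter.dupNamespace false

open scoped Manifold ContDiff ENNReal NNReal Topology
open MeasureTheory Set Filter
open Literature.Geometry.Lorentzian Literature.Geometry.Riemannian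

namespace Summit.SmoothPoincare4.SmoothPoincare4.Theorems.NoncompactShrinkerGapCompactSupportLSI

/-! ## The mixture step and the inequality on a complete shrinker (any dimension) -/

section Shrinker

variable {n : ℕ} {M : Type} [TopologicalSpace M] [T2Space M] [SecondCountableTopology M]
  [ChartedSpace (EuclideanSpace ℝ (Fin n)) M] [IsManifold (𝓡 n) ∞ M] [ConnectedSpace M]
  [T3Space M] [MeasurableSpace M] [BorelSpace M]

omit [T2Space M] [ConnectedSpace M] in
/-- **The mixture step.** On a Riemannian manifold with `R ≥ 0`, a smooth `f ≥ 0` with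
`e^{-f}, f e^{-f}, R e^{-f}, |∇f|² e^{-f} ∈ L¹`, `d(p, ·)² ≤ 8f + K`, and a smooth compactly
supported `w` with `Z = ∫ w² > 0`: if clause (ii) of Carrillo–Ni holds for the constant `c` with
`log ∫e^{-f} = c − log (4π)^{-n/2}` and `∫ (R + |∇f|² + f + c − n) e^{-f} = c ∫ e^{-f}` (clause
(iii)), then for `0 < δ < 1` the smooth compatible `ψ_δ = log (4π)^{-n/2} − log u_δ`,
`u_δ = (1−δ) w²/Z + δ e^{-f}/∫e^{-f}`, is admissible in (ii) and integrating the pointwise bound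
`mixture_integrand_le` of its `𝒲`-integrand gives
`c ≤ (1−δ) F(w) + δ c − (1−δ) log (1−δ) − δ log δ`,
`F(w) = (∫ (R w² + 4|∇w|² − w² log w²))/Z + log Z + log (4π)^{-n/2} − n`. [folklore] -/
theorem mixture_step
    (g : PseudoRiemannianMetric (𝓡 n) ∞ (EuclideanSpace ℝ (Fin n)) (TangentSpace (𝓡 n) : M → Type _))
    [g.HasLeviCivita] {f w : M → ℝ} (hg : g.IsRiemannian)
    (hf : ContMDiff (𝓡 n) 𝓘(ℝ, ℝ) ∞ f) (hw : ContMDiff (𝓡 n) 𝓘(ℝ, ℝ) ∞ w)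
    (hwc : HasCompactSupport w) (hS0 : ∀ x, 0 ≤ g.scalarCurvature x) (hf0 : ∀ x, 0 ≤ f x)
    (hint : Integrable (fun x ↦ Real.exp (-f x)) g.riemVolume)
    (hfint : Integrable (fun x ↦ f x * Real.exp (-f x)) g.riemVolume)
    (hSint : Integrable (fun x ↦ g.scalarCurvature x * Real.exp (-f x)) g.riemVolume)
    (hgradint : Integrable (fun x ↦ g.gradSq f x * Real.exp (-f x)) g.riemVolume)
    {p : M} {K : ℝ} (hD2 : ∀ x, (g.riemEDist p x).toReal ^ 2 ≤ 8 * f x + K)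
    (hDm : Measurable fun x ↦ (g.riemEDist p x).toReal)
    (hZ : 0 < ∫ x, w x ^ 2 ∂g.riemVolume) (hI₀pos : 0 < ∫ x, Real.exp (-f x) ∂g.riemVolume)
    {c : ℝ} (hcA : Real.log (∫ x, Real.exp (-f x) ∂g.riemVolume) =
      c - Real.log ((4 * Real.pi) ^ (-(n : ℝ) / 2)))
    (hLSI : ∀ ψ : M → ℝ, ContMDiff (𝓡 n) 𝓘(ℝ, ℝ) ∞ ψ → g.IsEntropyCompatible ψ 1 →
      (∃ o : M, Integrable (fun x ↦ (g.riemEDist o x).toReal ^ 2 * entropyDensity n ψ 1 x)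
        g.riemVolume) →
      Integrable (fun x ↦ ((g.scalarCurvature x + g.gradSq ψ x) + ψ x - n) *
        entropyDensity n ψ 1 x) g.riemVolume →
      c ≤ g.wEntropy g.leviCivita ψ 1)
    (hWf : ∫ x, (g.scalarCurvature x + g.gradSq f x + (f x + c) - n) * Real.exp (-f x)
      ∂g.riemVolume = (∫ x, Real.exp (-f x) ∂g.riemVolume) * c)
    {δ : ℝ} (hδ0 : 0 < δ) (hδ1 : δ < 1) :
    c ≤ (1 - δ) * ((∫ x, (g.scalarCurvature x * w x ^ 2 + 4 * g.gradSq w x -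
        w x ^ 2 * Real.log (w x ^ 2)) ∂g.riemVolume) / (∫ x, w x ^ 2 ∂g.riemVolume) +
        Real.log (∫ x, w x ^ 2 ∂g.riemVolume) + Real.log ((4 * Real.pi) ^ (-(n : ℝ) / 2)) - n) +
      δ * c + (Real.negMulLog (1 - δ) + Real.negMulLog δ) := by
  classical
  haveI := CarrilloNi2009_shrinkerLSI.isFiniteMeasureOnCompacts_riemVolume hg
  set vol := g.riemVolume with hvol
  set I₀ : ℝ := ∫ x, Real.exp (-f x) ∂vol with hI₀
  set A : ℝ := (4 * Real.pi) ^ (-(n : ℝ) / 2) with hA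
  set Z : ℝ := ∫ x, w x ^ 2 ∂vol with hZdef
  set J : ℝ := ∫ x, (g.scalarCurvature x * w x ^ 2 + 4 * g.gradSq w x -
    w x ^ 2 * Real.log (w x ^ 2)) ∂vol with hJ
  have hApos : 0 < A := Real.rpow_pos_of_pos (by positivity) _
  have h1δ : 0 < 1 - δ := by linarith
  /- continuity and support bookkeeping -/
  have hScont : Continuous fun x ↦ g.scalarCurvature x :=
    (PseudoRiemannianMetric.contMDiff_scalarCurvature g).continuous
  have hgradcont : ∀ {φ : M → ℝ}, ContMDiff (𝓡 n) 𝓘(ℝ, ℝ) ∞ φ → Continuous (g.gradSq φ) :=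
    fun hφ ↦ continuous_innerDual_mvfderiv g (hφ.of_le (by norm_num)) (hφ.of_le (by norm_num))
  have hwcont : Continuous w := hw.continuous
  have hw0 : ∀ x, x ∉ tsupport w → w x = 0 := fun x hx ↦ image_eq_zero_of_notMem_tsupport hx
  have hgw0 : ∀ x, x ∉ tsupport w → g.gradSq w x = 0 := fun x hx ↦
    g.gradSq_eq_zero_of_mvfderiv_eq_zero (mvfderiv_eq_zero_of_notMem_tsupport hx)
  have intK : ∀ {F : M → ℝ}, Continuous F → (∀ x, x ∉ tsupport w → F x = 0) →
      Integrable F vol := fun hF h0 ↦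
    hF.integrable_of_hasCompactSupport (HasCompactSupport.intro hwc h0)
  have hw2i : Integrable (fun x ↦ w x ^ 2) vol :=
    intK (hwcont.pow 2) (fun x hx ↦ by simp [hw0 x hx])
  have hJi : Integrable (fun x ↦ g.scalarCurvature x * w x ^ 2 + 4 * g.gradSq w x -
      w x ^ 2 * Real.log (w x ^ 2)) vol :=
    intK ((hScont.mul (hwcont.pow 2)).add (continuous_const.mul (hgradcont hw)) |>.sub
      (Real.continuous_mul_log.comp (hwcont.pow 2))) (fun x hx ↦ by simp [hw0 x hx, hgw0 x hx])
  obtain ⟨Cw, hCw⟩ := hwcont.bounded_above_of_compact_support hwc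
  have hwsq : ∀ x, w x ^ 2 ≤ Cw ^ 2 := fun x ↦ by
    have h := hCw x
    rw [Real.norm_eq_abs] at h
    have : |w x| ^ 2 ≤ Cw ^ 2 := pow_le_pow_left₀ (abs_nonneg _) h 2
    rwa [sq_abs] at this
  have hE1 : ∀ x, Real.exp (-f x) ≤ 1 := fun x ↦ Real.exp_le_one_iff.2 (by linarith [hf0 x])
  /- the mixture -/
  set α : ℝ := (1 - δ) / Z with hα
  set β : ℝ := δ / I₀ with hβ
  have hα0 : 0 < α := div_pos h1δ hZ
  have hβ0 : 0 < β := div_pos hδ0 hI₀pos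
  set u : M → ℝ := fun x ↦ α * w x ^ 2 + β * Real.exp (-f x) with hu
  set ψ : M → ℝ := fun x ↦ Real.log A - Real.log (u x) with hψ
  have hux : ∀ x, u x = α * w x ^ 2 + β * Real.exp (-f x) := fun x ↦ rfl
  have hψx : ∀ x, ψ x = Real.log A - Real.log (u x) := fun x ↦ rfl
  have hupos : ∀ x, 0 < u x := fun x ↦ by rw [hux]; positivity
  set Umax : ℝ := α * Cw ^ 2 + β with hUmax
  have hule : ∀ x, u x ≤ Umax := fun x ↦ by
    rw [hux, hUmax]
    have h1 : α * w x ^ 2 ≤ α * Cw ^ 2 := mul_le_mul_of_nonneg_left (hwsq x) hα0.le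
    have h2 : β * Real.exp (-f x) ≤ β := by nlinarith [hE1 x]
    linarith
  -- smoothness
  have hEs : ContMDiff (𝓡 n) 𝓘(ℝ, ℝ) ∞ (fun x ↦ Real.exp (-f x)) :=
    (Real.contDiff_exp.comp contDiff_neg).comp_contMDiff hf
  have hus : ContMDiff (𝓡 n) 𝓘(ℝ, ℝ) ∞ u :=
    (((contMDiff_const (c := α)).mul (hw.mul hw)).add ((contMDiff_const (c := β)).mul hEs)).congr
      (fun x ↦ by simp only [hux, Pi.add_apply, Pi.mul_apply]; ring)
  have hψs : ContMDiff (𝓡 n) 𝓘(ℝ, ℝ) ∞ ψ := fun x ↦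
    (contDiffAt_const.sub (Real.contDiffAt_log.2 (hupos x).ne')).comp_contMDiffAt (hus x)
  have hucont : Continuous u := hus.continuous
  -- the density of `ψ` is `u`
  have hdens : ∀ x, entropyDensity n ψ 1 x = u x := by
    intro x
    rw [entropyDensity_apply, mul_one, ← hA, hψx, neg_sub, Real.exp_sub, Real.exp_log (hupos x),
      Real.exp_log hApos]
    field_simp
  -- integrability of `F u` from that of `F e^{-f}`
  have intU : ∀ {F : M → ℝ}, Continuous F → Integrable (fun x ↦ F x * Real.exp (-f x)) vol →
      Integrable (fun x ↦ F x * u x) vol := by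
    intro F hF hFe
    have h1 : Integrable (fun x ↦ F x * w x ^ 2) vol :=
      intK (hF.mul (hwcont.pow 2)) (fun x hx ↦ by simp [hw0 x hx])
    exact ((h1.const_mul α).add (hFe.const_mul β)).congr
      (ae_of_all _ fun x ↦ by simp only [hux, Pi.add_apply]; ring)
  have hu_int : Integrable u vol := by
    have := intU continuous_const (F := fun _ ↦ (1 : ℝ)) (by simpa using hint)
    simpa using this
  have hfu : Integrable (fun x ↦ f x * u x) vol := intU hf.continuous hfint
  have hu_one : ∫ x, u x ∂vol = 1 := by
    simp only [hux]
    rw [integral_add (hw2i.const_mul α) (hint.const_mul β), integral_const_mul,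
      integral_const_mul, ← hZdef, ← hI₀, hα, hβ]
    field_simp
    ring
  have hcompat : g.IsEntropyCompatible ψ 1 := by
    rw [PseudoRiemannianMetric.isEntropyCompatible_iff, finrank_euclideanSpace_fin]
    simp_rw [hdens]
    exact hu_one
  -- bounded second moment
  have h2 : Integrable (fun x ↦ (g.riemEDist p x).toReal ^ 2 * entropyDensity n ψ 1 x) vol := by
    simp_rw [hdens]
    have hmaj : Integrable (fun x ↦ 8 * (f x * u x) + K * u x) vol :=
      (hfu.const_mul 8).add (hu_int.const_mul _)
    refine hmaj.mono' ((hDm.pow_const 2).mul hucont.measurable).aestronglyMeasurable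
      (ae_of_all _ fun x ↦ ?_)
    rw [Real.norm_eq_abs, abs_of_nonneg (mul_nonneg (sq_nonneg _) (hupos x).le)]
    nlinarith [hD2 x, (hupos x).le]
  /- the `𝒲`-integrand and its two-sided bounds -/
  set Wi : M → ℝ := fun x ↦ ((g.scalarCurvature x + g.gradSq ψ x) + ψ x - n) * u x with hWi
  set K₁ : ℝ := Real.log Z + Real.log A - n - Real.log (1 - δ) with hK₁
  set K₂ : ℝ := -Real.log δ with hK₂
  set Wf : M → ℝ := fun x ↦ (g.scalarCurvature x + g.gradSq f x + (f x + c) - n) *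
    Real.exp (-f x) with hWf'
  set P : M → ℝ := fun x ↦ (g.scalarCurvature x * w x ^ 2 + 4 * g.gradSq w x -
    w x ^ 2 * Real.log (w x ^ 2)) + K₁ * w x ^ 2 with hP
  set Q : M → ℝ := fun x ↦ Wf x + K₂ * Real.exp (-f x) with hQ
  have hWle : ∀ x, Wi x ≤ α * P x + β * Q x := fun x ↦
    mixture_integrand_le (hux x)
      (gradSq_mixture_mul_le g hg (hw.mdifferentiableAt (by norm_num))
        (hf.mdifferentiableAt (by norm_num)) (Real.log A) hα0.le hβ0)
      (mixture_entropy_le hZ hI₀pos hδ0 hδ1 hcA (w x) (f x))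
  set L : ℝ := Real.log A - Real.log Umax with hL
  have hψge : ∀ x, L ≤ ψ x := fun x ↦ by
    rw [hψx, hL]
    linarith [Real.log_le_log (hupos x) (hule x)]
  have hWge : ∀ x, (L - n) * u x ≤ Wi x := fun x ↦ by
    have hWx : Wi x = g.scalarCurvature x * u x + g.gradSq ψ x * u x + ψ x * u x - n * u x := by
      simp only [hWi]; ring
    rw [hWx]
    nlinarith [mul_nonneg (hS0 x) (hupos x).le, mul_nonneg (g.gradSq_nonneg hg ψ x) (hupos x).le,
      mul_le_mul_of_nonneg_right (hψge x) (hupos x).le]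
  -- integrability of `P`, `Q`, `Wi`
  have hWfi : Integrable Wf vol :=
    (((hSint.add hgradint).add (hfint.add (hint.const_mul c))).sub (hint.const_mul (n : ℝ))).congr
      (ae_of_all _ fun x ↦ by simp only [hWf', Pi.add_apply, Pi.sub_apply]; ring)
  have hPi : Integrable P vol := hJi.add (hw2i.const_mul K₁)
  have hQi : Integrable Q vol := hWfi.add (hint.const_mul K₂)
  have hPQi : Integrable (fun x ↦ α * P x + β * Q x) vol := (hPi.const_mul α).add (hQi.const_mul β)
  have hWcont : Continuous Wi :=
    (((hScont.add (hgradcont hψs)).add hψs.continuous).sub continuous_const).mul hucont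
  have hWii : Integrable Wi vol :=
    integrable_of_le_of_le hWcont.aestronglyMeasurable hPQi (hu_int.const_mul _) hWge hWle
  /- clause (ii) for `ψ`, and integration of the pointwise bound -/
  have hWhyp : Integrable (fun x ↦ ((g.scalarCurvature x + g.gradSq ψ x) + ψ x - n) *
      entropyDensity n ψ 1 x) vol := by
    simp_rw [hdens]; exact hWii
  have hcW : c ≤ g.wEntropy g.leviCivita ψ 1 := hLSI ψ hψs hcompat ⟨p, h2⟩ hWhyp
  have hWval : g.wEntropy g.leviCivita ψ 1 = ∫ x, Wi x ∂vol := by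
    rw [PseudoRiemannianMetric.wEntropy_def, finrank_euclideanSpace_fin]
    simp_rw [one_mul, PseudoRiemannianMetric.scalarCurvatureWith_leviCivita, hdens]
    rfl
  have hPint : ∫ x, P x ∂vol = J + K₁ * Z := by
    simp only [hP]
    rw [integral_add hJi (hw2i.const_mul K₁), integral_const_mul]
  have hQint : ∫ x, Q x ∂vol = I₀ * c + K₂ * I₀ := by
    simp only [hQ]
    rw [integral_add hWfi (hint.const_mul K₂), integral_const_mul]
    simp only [hWf']
    rw [hWf]
  have hI : ∫ x, Wi x ∂vol ≤ α * (J + K₁ * Z) + β * (I₀ * c + K₂ * I₀) := by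
    calc ∫ x, Wi x ∂vol ≤ ∫ x, (α * P x + β * Q x) ∂vol := integral_mono hWii hPQi hWle
      _ = α * ∫ x, P x ∂vol + β * ∫ x, Q x ∂vol := by
          rw [integral_add (hPi.const_mul α) (hQi.const_mul β), integral_const_mul,
            integral_const_mul]
      _ = _ := by rw [hPint, hQint]
  have hαZ : α * (J + K₁ * Z) = (1 - δ) * (J / Z + K₁) := by
    rw [hα]; field_simp
  have hβI : β * (I₀ * c + K₂ * I₀) = δ * (c + K₂) := by
    rw [hβ]; field_simp
  rw [hWval] at hcW
  have := hcW.trans hI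
  rw [hαZ, hβI, hK₁, hK₂] at this
  simp only [Real.negMulLog]
  linarith

/-- **Carrillo–Ni's LSI for compactly supported test functions** (Haslhofer–Müller 2011,
(2.15)–(2.16)), any dimension `n`, from the two named facts: on a complete connected gradient
shrinker normalised by `R + |∇f|² = f`, for `w` smooth with compact support and `Z = ∫ w² > 0`,
`log((4π)^{-n/2}∫e^{-f}) ≤ (∫ (R w² + 4|∇w|² − w² log w²))/Z + log Z + log (4π)^{-n/2} − n`.
Proof: `f` is proper (`shrinkerPotentialGrowth` + compact balls), whence the weighted
integrability (`ShrinkerEntropyProofs`) and `d(p,·)² ≤ 8f + 50n²`; Carrillo–Ni (i)–(iii); the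
mixture step `mixture_step` for every `0 < δ < 1`; `δ → 0` (`le_of_forall_mixture_bound`).
[folklore] -/
theorem log_le_functional
    (g : PseudoRiemannianMetric (𝓡 n) ∞ (EuclideanSpace ℝ (Fin n)) (TangentSpace (𝓡 n) : M → Type _))
    [g.HasLeviCivita] (f : M → ℝ) (hg : g.IsRiemannian)
    (hgrowth : shrinkerPotentialGrowth) (hCN : CarrilloNi2009_shrinkerLSI)
    (hc : ∀ (x : M) (r : NNReal), IsCompact {y : M | g.edist hg x y ≤ r})
    (hf : ContMDiff (𝓡 n) 𝓘(ℝ, ℝ) ∞ f)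
    (hsol : ∀ (x : M) (X Y : TangentSpace (𝓡 n) x),
      g.ricci x X Y + g.hessian f x X Y = (1 / 2 : ℝ) * g.val x X Y)
    (hnorm : ∀ x : M, g.scalarCurvature x + g.gradSq f x = f x)
    {w : M → ℝ} (hw : ContMDiff (𝓡 n) 𝓘(ℝ, ℝ) ∞ w) (hwc : HasCompactSupport w)
    (hZ : 0 < ∫ x, w x ^ 2 ∂g.riemVolume) :
    Real.log ((4 * Real.pi) ^ (-(n : ℝ) / 2) * ∫ x, Real.exp (-f x) ∂g.riemVolume) ≤
      (∫ x, (g.scalarCurvature x * w x ^ 2 + 4 * g.gradSq w x - w x ^ 2 * Real.log (w x ^ 2))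
          ∂g.riemVolume) / (∫ x, w x ^ 2 ∂g.riemVolume) + Real.log (∫ x, w x ^ 2 ∂g.riemVolume) +
        Real.log ((4 * Real.pi) ^ (-(n : ℝ) / 2)) - n := by
  classical
  /- the two facts -/
  obtain ⟨C₂, hC₂⟩ := hgrowth n
  obtain ⟨hS0, p, -, hlow, -, -⟩ := hC₂ M g f hg hc hf hsol hnorm
  haveI : Nonempty M := ⟨p⟩
  have hc' : ∀ (x : M) (r : NNReal), IsCompact {y : M | g.riemEDist x y ≤ r} := fun x r ↦ by
    simpa [PseudoRiemannianMetric.riemEDist_eq hg] using hc x r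
  obtain ⟨hint, -, hLSI, hsharp⟩ := hCN n M g f hg hc' hf hsol hnorm
  set vol := g.riemVolume with hvol
  set I₀ : ℝ := ∫ x, Real.exp (-f x) ∂vol with hI₀
  set A : ℝ := (4 * Real.pi) ^ (-(n : ℝ) / 2) with hA
  set c : ℝ := Real.log (A * I₀) with hcdef
  have hApos : 0 < A := Real.rpow_pos_of_pos (by positivity) _
  have hΘpos : 0 < A * I₀ := CarrilloNi2009_shrinkerLSI.theta_pos hg hint
  have hI₀pos : 0 < I₀ := pos_of_mul_pos_right hΘpos hApos.le
  have hcA : Real.log I₀ = c - Real.log A := by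
    rw [hcdef, Real.log_mul hApos.ne' hI₀pos.ne']; ring
  have hf0 : ∀ x, 0 ≤ f x := fun x ↦ by linarith [hnorm x, hS0 x, g.gradSq_nonneg hg f x]
  /- properness of `f`, weighted integrability of `f, R, |∇f|²` -/
  have hprop : ∀ R : ℝ, IsCompact {x | f x ≤ R} :=
    isCompact_sublevel_of_growth hg hf.continuous hc hlow
  obtain ⟨-, hfint⟩ :=
    CarrilloNi2009_shrinkerLSI.integrable_exp_neg_of_proper hg hf hsol hnorm hprop
  obtain ⟨hSint, hgradint⟩ :=
    CarrilloNi2009_shrinkerLSI.integrable_gradSq_mul_exp_neg_of_proper hg hf hsol hnorm hprop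
      (B := 0) (fun x ↦ by rw [neg_zero]; exact hS0 x)
  /- the distance to `p`: `d(p, x)² ≤ 8 f(x) + 50 n²`, measurability -/
  have hD2 : ∀ x, (g.riemEDist p x).toReal ^ 2 ≤ 8 * f x + 2 * (5 * (n : ℝ)) ^ 2 := fun x ↦ by
    have hfin : g.edist hg p x < ⊤ := by
      simpa [PseudoRiemannianMetric.riemEDist_eq hg] using
        CarrilloNi2009_shrinkerLSI.riemEDist_lt_top hg p x
    rw [PseudoRiemannianMetric.riemEDist_eq hg]
    exact toReal_edist_sq_le hg (hlow x) hfin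
  have hDm : Measurable fun x ↦ (g.riemEDist p x).toReal := by
    have hcont : Continuous fun x ↦ g.edist hg p x :=
      (PseudoRiemannianMetric.continuous_edist hg).comp (Continuous.prodMk_right p)
    simp_rw [PseudoRiemannianMetric.riemEDist_eq hg]
    exact hcont.measurable.ennreal_toReal
  /- clause (iii): `∫ (R + |∇f|² + f + c − n) e^{-f} = c ∫ e^{-f}` -/
  have hdens_f : ∀ x, entropyDensity n (fun y ↦ f y + c) 1 x = I₀⁻¹ * Real.exp (-f x) := by
    intro x
    have hd := CarrilloNi2009_shrinkerLSI.entropyDensity_add_log hg hint x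
    rw [← hI₀, ← hA, ← hcdef] at hd
    rw [hd]
    field_simp
  have hWf : ∫ x, (g.scalarCurvature x + g.gradSq f x + (f x + c) - n) * Real.exp (-f x) ∂vol =
      I₀ * c := by
    have hs := hsharp
    rw [PseudoRiemannianMetric.wEntropy_def, finrank_euclideanSpace_fin] at hs
    simp_rw [one_mul, PseudoRiemannianMetric.scalarCurvatureWith_leviCivita, hdens_f,
      show ∀ x, g.gradSq (fun y ↦ f y + c) x = g.gradSq f x from fun x ↦
        CarrilloNi2009_shrinkerLSI.gradSq_add_const c (hf.mdifferentiableAt (by norm_num))] at hs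
    have h1 : ∫ x, (g.scalarCurvature x + g.gradSq f x + (f x + c) - (n : ℕ)) *
        (I₀⁻¹ * Real.exp (-f x)) ∂vol = I₀⁻¹ * ∫ x, (g.scalarCurvature x + g.gradSq f x +
          (f x + c) - n) * Real.exp (-f x) ∂vol := by
      rw [← integral_const_mul]
      refine integral_congr_ae (ae_of_all _ fun x ↦ ?_)
      ring
    rw [h1] at hs
    field_simp at hs
    linarith [hs]
  /- the mixture step for every `0 < δ < 1`, and `δ → 0` -/
  exact le_of_forall_mixture_bound fun δ hδ0 hδ1 ↦
    mixture_step g hg hf hw hwc hS0 hf0 hint hfint hSint hgradint hD2 hDm hZ hI₀pos hcA hLSI hWf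
      hδ0 hδ1

end Shrinker

/-! ## The registered stub (`n = 4`) -/

/-- **Stub `stub_compactSupportLSI` (U1) of line `collapsed-ends-usc`** — Carrillo–Ni's
logarithmic Sobolev inequality on a complete connected normalised 4-d gradient shrinker for
compactly supported smooth `w` (Haslhofer–Müller 2011, (2.15)–(2.16)):
`log((4π)⁻² ∫ e^{-f}) ≤ (∫ (R w² + 4|∇w|² − w² log w²))/∫w² + log ∫w² − log (4π)² − 4`, from the
named facts `shrinkerPotentialGrowth` and `CarrilloNi2009_shrinkerLSI` (`log_le_functional` at
`n = 4`). The bound `R ≤ C` is not used. [folklore] -/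
theorem stub_compactSupportLSI : shrinkerPotentialGrowth → CarrilloNi2009_shrinkerLSI → ∀ (M : Type) [TopologicalSpace M] [T2Space M] [SecondCountableTopology M] [ChartedSpace E4 M] [IsManifold (𝓡 4) ∞ M] [ConnectedSpace M] [T3Space M] [MeasurableSpace M] [BorelSpace M] (g : PseudoRiemannianMetric (𝓡 4) ∞ E4 (TangentSpace (𝓡 4) : M → Type _)) [g.HasLeviCivita] (f : M → ℝ) (hg : g.IsRiemannian), (∀ (x : M) (r : NNReal), IsCompact {y : M | g.edist hg x y ≤ r}) → ContMDiff (𝓡 4) 𝓘(ℝ, ℝ) ∞ f → (∀ (x : M) (X Y : TangentSpace (𝓡 4) x), g.ricci x X Y + g.hessian f x X Y = (1 / 2 : ℝ) * g.val x X Y) → (∀ x : M, g.scalarCurvature x + g.gradSq f x = f x) → (∃ C : ℝ, ∀ x : M, g.scalarCurvature x ≤ C) → ∀ w : M → ℝ, ContMDiff (𝓡 4) 𝓘(ℝ, ℝ) ∞ w → HasCompactSupport w → 0 < ∫ x, w x ^ 2 ∂g.riemVolume → Real.log ((4 * Real.pi) ^ (-(4 : ℝ) / 2) * ∫ x, Real.exp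 (-f x) ∂g.riemVolume) ≤ (∫ x, (g.scalarCurvature x * w x ^ 2 + 4 * g.gradSq w x - w x ^ 2 * Real.log (w x ^ 2)) ∂g.riemVolume) / (∫ x, w x ^ 2 ∂g.riemVolume) + Real.log (∫ x, w x ^ 2 ∂g.riemVolume) - Real.log ((4 * Real.pi) ^ 2) - 4 := by
  intro hgrowth hCN M _ _ _ _ _ _ _ _ _ g _ f hg hc hf hsol hnorm _ w hw hwc hZ
  have h := log_le_functional (n := 4) g f hg hgrowth hCN hc hf hsol hnorm hw hwc hZ
  have hlogA : Real.log ((4 * Real.pi) ^ (-(4 : ℝ) / 2)) = -Real.log ((4 * Real.pi) ^ 2) := by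
    rw [show (-(4 : ℝ) / 2) = -(2 : ℝ) by norm_num, Real.rpow_neg (by positivity), Real.log_inv,
      Real.rpow_two]
  simp only [Nat.cast_ofNat] at h
  rw [hlogA] at h
  linarith

end Summit.SmoothPoincare4.SmoothPoincare4.Theorems.NoncompactShrinkerGapCompactSupportLSI

end
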